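import Summits.ResolutionOfSingularities.ResolutionOfSingularities.Theorems.CompanionTransport
import HarnessLib

/-!
# CompanionTowers — decomp-res node «CompanionCut» (lens-4 g26, critic row 154), tree file 5/7 of the node

Content VERBATIM from the decomp-res lens-4 g26 node `HOME/decomp-res-lens-4/g26/CompanionCut.lean` (pin 12d9bf52, 1
262 l, 56 declarations;
HOME = run/shared/lean/pub/decomp-res) = ONE NEW PART §66–§70, NO CARRY, on top of the landed
`Theorems/HeightCutCells` (g25) +
`Theorems/MaxContactCutKangarooCut` (h71 wiring) + `Theorems/ContactFreeIsPPower` (lens-6).  Critic: CRITIC-LEDGER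
row 154 (CLEARED
2026-08-30T23:45:15Z, DECIDED +1 (ii*): THE COMPANION LAW at every weight — Hasse descent of a `p^e`-power form to
a weight-`p^e`
companion with LINEAR weak contact, Giraud transport with a typed jump dichotomy in every weight, the deciding implication
«eventually companion-jump-free ⇒ 31571's class» and the EXACT re-location of the g25 residual
`NoWildKangarooOffDoublePointTowers`
to the companion-recurrent towers `NoWildCompanionKangarooTowers`; inhabitants both sides).  Landing orders INBOX
:519 (lens-4 g26
landing note, split per NEXT-g27 §4) and :528 (critic): `--kind proof --supports
stmt-ResolutionOfSingularities-28338`, namespace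
`…Theorems.HugValuationCut`.  Landed by decomp-res writer g8 CONE-AWARE in seven files: `CompanionAlgebra` ·
`CompanionHasse` ·
`CompanionPresentation` (§66–§67) · `CompanionTransport` (§68) · `CompanionTowers` (§69) ·
`CompanionCutCells` (§70 cone-free cells and
hypothesis-free re-locations) are OUTSIDE the Theses cone (importable by the route file); the five §70 corollaries GIVEN 31571
`MaxContactCut.NoContactHuggingTowers` BY NAME are the in-cone wiring file `MaxContactCutCompanionCut`.  Aside
bookkeeping (row 154):
ONE successor aside on the lens-4 column, `NoWildCompanionKangarooTowers` (home `CompanionCutCells`) SUPERSEDING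
`HCNoWildKangarooOffDoublePointTowers` (g25, route rev 43); exactness `noWildKangarooOffDoublePointTowers_iff_companion (h71)`;
the decided cell `NoWildCompanionJumpFreeTowers` (⟸ 31571, `noWildCompanionJumpFreeTowers_of_item`) is not filed.

§69 (l. 950–1129) THE COMPANION KANGAROO LAW ALONG FORCED TOWERS (L3): `cInv_succ_transport`,
`cInv_or_cTailJump_succ`, `CJumpFreeFrom`,
`EventuallyCompanionJumpFree`, THE DECIDING THEOREM `contactHugging_of_eventuallyCompanionJumpFree` (⊆ 31571's
class by letter),
`exists_cInv_stage` (perfect field), `companion_hugs_one_step`, `eventuallyCompanionJumpFree_of_eventuallyJumpFree`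
(STRICT GROWTH over
g24/g25), `exists_cTailJump_of_not_eventuallyCompanionJumpFree`.  PROVED, 0 sorry.  Imports `CompanionTransport`.  Cone-free.

[WRITER NOTE (decomp-res writer g8): section split only (400-line cap; §66 `section CompanionAlgebra` is re-opened
with the same
`variable` lines in `CompanionHasse` / `CompanionPresentation`); namespace, universes, section variables and every
declaration exactly
as in the lens (global `set_option` dropped; the lens's in-cone import `MaxContactCutKangarooCut` and the `open
…Theses` line live only
in the wiring file `MaxContactCutCompanionCut`).]

(Sources: Giraud1975 Thm 5.2; EncinasVillamayor2000 Thm 4.9; BravoGarciaEscamillaEncinasVillamayor2012 Lemma 4.6;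
KawanoueMatsuki2010; Kawanoue arXiv:math/0607009; CossartPiltant2008 §2; Cossart2011 ex. III.2; Hauser
arXiv:0811.4151; FruehbisKrueger arXiv:1007.2203 §3; BenitoVillamayor arXiv:1004.1803; Lucas 1878.)
-/

noncomputable section

open CategoryTheory AlgebraicGeometry IsLocalRing
open Literature.AlgebraicGeometry.Resolution
open Summit.ResolutionOfSingularities.ResolutionOfSingularities.Theorems
open WeakOrderReduction ForcedTowerClasses DivergentTowerClasses MonomialTowerClasses
open HugDimensionClasses HugDimensionKernels SurfaceShadowClasses SurfaceShadowKernels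
open NearPointCut (SingularClass)
open AbsoluteContactClasses (IsAbsContactAt SepResidueAt diffIdeal_restrict_le stalkMap_comp_toStalk_eq_stalkHom)
open scoped BigOperators

namespace Summit.ResolutionOfSingularities.ResolutionOfSingularities.Theorems.HugValuationCut

/-! ## §69 THE COMPANION KANGAROO LAW ALONG FORCED TOWERS (every weight, every field for transport; perfect field
for existence) -/

section CompanionTowers

variable {k : Type} [Field k]

/-- **COMPANION TRANSPORT ALONG THE TOWER (KERNEL, PROVED, every field)**: the companion invariant of weight `w` (`1
≤ w ≤ n`)
at stage `i` along `H` puts the next marked point ON THE STRICT TRANSFORM OF `H`, keeps it a regular hypersurface germ there,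
transports the companion element into the companion of the next stage (Giraud), and leaves an exceptionally divisible tail.
(Sources: Giraud1975; BravoGarciaEscamillaVillamayor2012, Lemma 4.6; Hauser2010Kangaroo; EncinasVillamayor2000, Thm. 4.9.) -/
theorem cInv_succ_transport (T : ForcedTower) (g : T.St 0 ⟶ Spec (.of k)) (hB : IsBase (T.St 0) g) {w n : ℕ}
    (hw : 1 ≤ w) (hwn : w ≤ n) (hD : IsDatum n (T.D 0)) (i : ℕ) (H : (T.St i).IdealSheafData)
    (h : CInv w (T.D i).ideal H n (T.pt i)) :
    ∃ z' : (T.St (i + 1)).presheaf.stalk (T.pt (i + 1)),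
      stalkIdeal (strictTransformIdeal (T.π i) (T.centre i) H) (T.pt (i + 1)) = Ideal.span {z'} ∧
      z' ∈ maximalIdeal _ ∧ z' ∉ maximalIdeal _ ^ 2 ∧
      ∃ g' ∈ diffIdeal ℤ (n - w) (stalkIdeal (T.D (i + 1)).ideal (T.pt (i + 1))),
        ∃ c' : (T.St (i + 1)).presheaf.stalk (T.pt (i + 1)),
          IsUnit c' ∧ g' - c' * z' ^ w ∈ stalkIdeal ((T.centre i).comap (T.π i)) (T.pt (i + 1)) := by
  obtain ⟨hNi, hRi⟩ := tower_isLocallyNoetherian_isRegular T g hB i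
  obtain ⟨hNi1, -⟩ := tower_isLocallyNoetherian_isRegular T g hB (i + 1)
  haveI := hNi
  haveI := hNi1
  have hπ := T.isBlowup i
  have hy : (T.π i).base (T.pt (i + 1)) = T.pt i := T.pt_map i
  have hDi1 : (T.D (i + 1)).ideal = controlledTransform (T.π i) (T.centre i) (T.D i).ideal n := by
    rw [T.transform_eq i, MarkedIdeal.transform_ideal, tower_mult_eq T hD i]
  rw [hDi1]
  have h' : CInv w (T.D i).ideal H n ((T.π i).base (T.pt (i + 1))) := by rw [hy]; exact h
  have hIn : stalkIdeal (T.D i).ideal ((T.π i).base (T.pt (i + 1))) ≤ maximalIdeal _ ^ n := by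
    rw [hy]; exact tower_stalkIdeal_le_pow T hD i
  have hI' : stalkIdeal (controlledTransform (T.π i) (T.centre i) (T.D i).ideal n) (T.pt (i + 1)) ≤
      maximalIdeal _ ^ (n - w + 1) := by
    have h1 := tower_stalkIdeal_le_pow T hD (i + 1)
    rw [hDi1] at h1
    exact h1.trans (Ideal.pow_le_pow_right (by omega))
  have hpt' : ((T.centre i).support : Set (T.St i)) = {(T.π i).base (T.pt (i + 1))} := by
    rw [hy]; exact T.centre_support i
  have hcl : IsClosed ({(T.π i).base (T.pt (i + 1))} : Set (T.St i)) := by rw [hy]; exact T.isClosed_pt i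
  exact cInv_point_transport hπ hRi (T.centre_regular i) _ H hwn _ hcl hpt' hIn hI' h'

/-- **THE COMPANION DICHOTOMY AT EVERY STAGE (KERNEL, PROVED)**: companion contact of weight `w` at stage `i` along `H` ⟹ at
stage `i + 1`, along the strict transform, EITHER companion contact again (no jump) OR a typed companion jump.
(Sources: Giraud1975; Hauser2010Kangaroo; Moh1987.) -/
theorem cInv_or_cTailJump_succ (T : ForcedTower) (g : T.St 0 ⟶ Spec (.of k)) (hB : IsBase (T.St 0) g) {w n : ℕ}
    (hw : 1 ≤ w) (hwn : w ≤ n) (hD : IsDatum n (T.D 0)) (i : ℕ) (H : (T.St i).IdealSheafData)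
    (h : CInv w (T.D i).ideal H n (T.pt i)) :
    CInv w (T.D (i + 1)).ideal (strictTransformIdeal (T.π i) (T.centre i) H) n (T.pt (i + 1)) ∨
      CTailJumpAt w (T.D (i + 1)).ideal (strictTransformIdeal (T.π i) (T.centre i) H) ((T.centre i).comap (T.π i)) n
        (T.pt (i + 1)) := by
  obtain ⟨z', hH', hz'm, hz'2, g', hg', c', hc', hgz⟩ := cInv_succ_transport T g hB hw hwn hD i H h
  by_cases hj : g' - c' * z' ^ w ∈ maximalIdeal _ ^ (w + 1)
  · exact Or.inl ⟨z', hH', hz'm, hz'2, g', hg', c', hc', hj⟩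
  · exact Or.inr ⟨z', hH', hz'm, hz'2, g', hg', c', hc', hgz, hj⟩

/-- **`CJumpFreeFrom T w n m H` — NO COMPANION JUMP OF WEIGHT `w` FROM STAGE `m` ON, along the germ ideal `H`** (NEW TYPED
PREDICATE): the companion invariant of weight `w` holds at EVERY stage `m + j` along the iterated strict transform of `H`. -/
def CJumpFreeFrom (T : ForcedTower) (w n m : ℕ) (H : (T.St m).IdealSheafData) : Prop :=
  ∀ j, CInv w (T.D (m + j)).ideal (strictIter T m H j) n (T.pt (m + j))

/-- **`EventuallyCompanionJumpFree n T` — FINITELY MANY COMPANION JUMPS IN SOME WEIGHT `1 ≤ w ≤ n`**: from some stage on,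
along some germ, the weight-`w` companion keeps linear weak contact along the transported germ (NEW TYPED PREDICATE; the DECIDED
side of the g26 cut; `w = n` is g24's `EventuallyJumpFree`, so the decided bed STRICTLY GROWS). -/
def EventuallyCompanionJumpFree (n : ℕ) (T : ForcedTower) : Prop :=
  ∃ (w m : ℕ) (H : (T.St m).IdealSheafData), 1 ≤ w ∧ w ≤ n ∧ CJumpFreeFrom T w n m H

/-- g24's jump-freeness is companion jump-freeness of weight `n`. [folklore] -/
theorem cJumpFreeFrom_of_jumpFreeFrom {T : ForcedTower} {n m : ℕ} {H : (T.St m).IdealSheafData} (h : JumpFreeFrom T n m H) :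
    CJumpFreeFrom T n n m H := fun j => (cInv_self_iff_wInv _ _ n _).mpr (h j)

/-- **the g24 decided bed lies in the g26 decided bed** (`w := n`). [folklore] -/
theorem eventuallyCompanionJumpFree_of_eventuallyJumpFree {n : ℕ} (hn : 1 ≤ n) {T : ForcedTower}
    (h : EventuallyJumpFree n T) : EventuallyCompanionJumpFree n T := by
  obtain ⟨m, H, hJ⟩ := h
  exact ⟨n, m, H, hn, le_rfl, cJumpFreeFrom_of_jumpFreeFrom hJ⟩

/-- **KERNEL (PROVED): a companion-jump-free germ is HUGGED FOR EVER.** [folklore] -/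
theorem hugsGerm_of_cJumpFreeFrom {T : ForcedTower} {w n m : ℕ} {H : (T.St m).IdealSheafData} (h : CJumpFreeFrom T w n m H) :
    HugsGerm T m H := by
  have h0 : CInv w (T.D m).ideal H n (T.pt m) := h 0
  refine ⟨?_, fun j => mem_support_of_cInv (h j)⟩
  rw [idealOrder_eq_one_of_cInv h0]
  exact ENat.coe_ne_top 1

/-- **THE DECIDING THEOREM (KERNEL, PROVED): A TOWER WITH FINITELY MANY COMPANION JUMPS HUGS A REGULAR HYPERSURFACE GERM FOR
EVER** — `EventuallyCompanionJumpFree n T → ContactHugging T`: the bed lies in 31571's class `ContactHugging` BY LETTER.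
(Sources: Giraud1975; Hauser2010Kangaroo; Moh1987.) -/
theorem contactHugging_of_eventuallyCompanionJumpFree {n : ℕ} {T : ForcedTower} (h : EventuallyCompanionJumpFree n T) :
    ContactHugging T := by
  obtain ⟨w, m, H, -, -, hJ⟩ := h
  exact ⟨m, H, idealOrder_eq_one_of_cInv (hJ 0), hugsGerm_of_cJumpFreeFrom hJ⟩

/-- **THE RESIDUAL'S SIGNATURE IS DERIVED, NOT ASSUMED (KERNEL, PROVED)**: companion contact of weight `w` at stage
`m` along `H`
and NOT companion-jump-free from `m` on ⟹ after finitely many jump-free stages a TYPED COMPANION JUMP occurs along the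
transported germ. (Sources: Giraud1975; Hauser2010Kangaroo; Moh1987.) -/
theorem exists_cTailJump_of_not_cJumpFreeFrom (T : ForcedTower) (g : T.St 0 ⟶ Spec (.of k)) (hB : IsBase (T.St 0) g)
    {w n : ℕ} (hw : 1 ≤ w) (hwn : w ≤ n) (hD : IsDatum n (T.D 0)) (m : ℕ) (H : (T.St m).IdealSheafData)
    (h0 : CInv w (T.D m).ideal H n (T.pt m)) (hJ : ¬ CJumpFreeFrom T w n m H) :
    ∃ j, CInv w (T.D (m + j)).ideal (strictIter T m H j) n (T.pt (m + j)) ∧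
      CTailJumpAt w (T.D (m + (j + 1))).ideal (strictIter T m H (j + 1))
        ((T.centre (m + j)).comap (T.π (m + j))) n (T.pt (m + (j + 1))) := by
  classical
  have hex : ∃ j, ¬ CInv w (T.D (m + j)).ideal (strictIter T m H j) n (T.pt (m + j)) := by
    by_contra hcon
    push Not at hcon
    exact hJ hcon
  have h0' : CInv w (T.D (m + 0)).ideal (strictIter T m H 0) n (T.pt (m + 0)) := h0
  have hpos : 0 < Nat.find hex := (Nat.find_pos hex).mpr (not_not.mpr h0')
  obtain ⟨j, hj⟩ : ∃ j, Nat.find hex = j + 1 := ⟨Nat.find hex - 1, by omega⟩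
  have hWj : CInv w (T.D (m + j)).ideal (strictIter T m H j) n (T.pt (m + j)) :=
    not_not.mp (Nat.find_min hex (show j < Nat.find hex by omega))
  have hnot : ¬ CInv w (T.D (m + (j + 1))).ideal (strictIter T m H (j + 1)) n (T.pt (m + (j + 1))) := by
    have h1 := Nat.find_spec hex
    rw [hj] at h1
    exact h1
  refine ⟨j, hWj, ?_⟩
  rcases cInv_or_cTailJump_succ T g hB hw hwn hD (m + j) (strictIter T m H j) hWj with h | h
  · exact absurd h hnot
  · exact h

/-- **spreading companion contact to a germ ideal (KERNEL, PROVED)**: on a Noetherian scheme, companion contact at `y` is the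
stage invariant `CInv w 𝓘 H n y` for SOME ideal sheaf `H` with `H_y = (z)` (tree `centreSpread`). [folklore] -/
theorem exists_cInv_of_companionContactAt {Y : Scheme.{0}} [IsNoetherian Y] {w n : ℕ} {I : Y.IdealSheafData} {y : Y}
    (h : CompanionContactAt w n I y) : ∃ H : Y.IdealSheafData, CInv w I H n y := by
  obtain ⟨z, hz, hz2, g, hgD, hgz⟩ := h
  have hz0 : z ≠ 0 := fun h0 => hz2 (by rw [h0]; exact zero_mem _)
  have hspan : Ideal.span (Set.range fun _ : Fin 1 => z) = Ideal.span {z} := by rw [Set.range_const]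
  obtain ⟨H, -, -, hHst⟩ := FInjectiveMacaulayfication.CentreSpread.centreSpread Y y 1 (fun _ => z)
      (by rw [hspan, Ne, Ideal.span_singleton_eq_bot]; exact hz0)
      (by rw [hspan]; exact (Ideal.span_singleton_le_iff_mem _).mpr hz)
  rw [hspan] at hHst
  exact ⟨H, z, hHst, hz, hz2, g, hgD, 1, isUnit_one, by rwa [one_mul]⟩

/-- **KERNEL (PROVED, over a PERFECT field): COMPANION CONTACT DATA EXIST AT EVERY STAGE OF EVERY TOWER OF THE CLASS** — at
stage `j` of a forced tower of weight `n ≥ 1` over a perfect field of characteristic `p` there are a weight `p^e ∣ n` (the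
Frobenius exponent of the stage ideal at the marked point) and a germ ideal `H` with `CInv (p^e) (T.D j).ideal H n (T.pt j)`:
THE COMPANION DICHOTOMY IS DEFINED AT EVERY STAGE OF EVERY TOWER — `p`-power or not, whatever the weight.
(Sources: Giraud1975; EGAIV4, Thm. 16.11.2; Hauser2010Kangaroo.) -/
theorem exists_cInv_stage {p : ℕ} (hp : p.Prime) [CharP k p] [PerfectField k] (T : ForcedTower)
    (g : T.St 0 ⟶ Spec (.of k)) (hB : IsBase (T.St 0) g) {n : ℕ} (hn : 1 ≤ n) (hD : IsDatum n (T.D 0)) (j : ℕ) :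
    ∃ (e : ℕ) (H : (T.St j).IdealSheafData), p ^ e ∣ n ∧ CInv (p ^ e) (T.D j).ideal H n (T.pt j) := by
  haveI : IsNoetherian (T.St j) := tower_isNoetherian T g hB j
  obtain ⟨e, hen, hC⟩ := exists_companionContactAt hp (toRoot T j ≫ g) (tower_isBase T g hB j) (T.D j).ideal
    (T.isClosed_pt j) hn (tower_idealOrder_pt_eq T g hB hD j)
  obtain ⟨H, hH⟩ := exists_cInv_of_companionContactAt hC
  exact ⟨e, H, hen, hH⟩

/-- **LAW (KERNEL, PROVED, over a PERFECT field): EVERY STAGE OF EVERY FORCED TOWER OF THE CLASS HUGS A REGULAR HYPERSURFACE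
FOR AT LEAST ONE MORE STEP** — at every stage `j` there is a regular hypersurface germ `V(H) ∋ x_j` (the companion's
weak-contact hypersurface) whose strict transform passes through `x_{j+1}`, with the companion dichotomy there (Giraud's
«the near points lie on the strict transform of the companion's hypersurface», typed). (Sources: Giraud1975;
Hauser2010Kangaroo.) -/
theorem companion_hugs_one_step {p : ℕ} (hp : p.Prime) [CharP k p] [PerfectField k] (T : ForcedTower)
    (g : T.St 0 ⟶ Spec (.of k)) (hB : IsBase (T.St 0) g) {n : ℕ} (hn : 1 ≤ n) (hD : IsDatum n (T.D 0)) (j : ℕ) :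
    ∃ (e : ℕ) (H : (T.St j).IdealSheafData), p ^ e ∣ n ∧ idealOrder H (T.pt j) = 1 ∧
      T.pt j ∈ (H.support : Set (T.St j)) ∧
      T.pt (j + 1) ∈ ((strictTransformIdeal (T.π j) (T.centre j) H).support : Set (T.St (j + 1))) ∧
      (CInv (p ^ e) (T.D (j + 1)).ideal (strictTransformIdeal (T.π j) (T.centre j) H) n (T.pt (j + 1)) ∨
        CTailJumpAt (p ^ e) (T.D (j + 1)).ideal (strictTransformIdeal (T.π j) (T.centre j) H)
          ((T.centre j).comap (T.π j)) n (T.pt (j + 1))) := by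
  obtain ⟨e, H, hen, hC⟩ := exists_cInv_stage hp T g hB hn hD j
  have hw : 1 ≤ p ^ e := Nat.one_le_pow _ _ hp.pos
  have hwn : p ^ e ≤ n := Nat.le_of_dvd (by omega) hen
  obtain ⟨z', hH', hz'm, -, -⟩ := cInv_succ_transport T g hB hw hwn hD j H hC
  refine ⟨e, H, hen, idealOrder_eq_one_of_cInv hC, mem_support_of_cInv hC, ?_,
    cInv_or_cTailJump_succ T g hB hw hwn hD j H hC⟩
  exact (mem_support_iff_stalkIdeal_le _ _).mpr (by rw [hH']; exact (Ideal.span_singleton_le_iff_mem _).mpr hz'm)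

/-- **THE COMPANION-RECURRENT SIGNATURE (KERNEL, PROVED)**: a tower that is NOT eventually companion-jump-free has, after
EVERY stage carrying companion contact of a weight `1 ≤ w ≤ n` along a germ, finitely many jump-free stages and then a TYPED
COMPANION JUMP along the transported germ. (Sources: Giraud1975; Hauser2010Kangaroo; Moh1987.) -/
theorem exists_cTailJump_of_not_eventuallyCompanionJumpFree (T : ForcedTower) (g : T.St 0 ⟶ Spec (.of k))
    (hB : IsBase (T.St 0) g) {w n : ℕ} (hw : 1 ≤ w) (hwn : w ≤ n) (hD : IsDatum n (T.D 0))
    (hT : ¬ EventuallyCompanionJumpFree n T) (m : ℕ) (H : (T.St m).IdealSheafData)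
    (h0 : CInv w (T.D m).ideal H n (T.pt m)) :
    ∃ j, CInv w (T.D (m + j)).ideal (strictIter T m H j) n (T.pt (m + j)) ∧
      CTailJumpAt w (T.D (m + (j + 1))).ideal (strictIter T m H (j + 1))
        ((T.centre (m + j)).comap (T.π (m + j))) n (T.pt (m + (j + 1))) :=
  exists_cTailJump_of_not_cJumpFreeFrom T g hB hw hwn hD m H h0 fun hJ => hT ⟨w, m, H, hw, hwn, hJ⟩

end CompanionTowers

end Summit.ResolutionOfSingularities.ResolutionOfSingularities.Theorems.HugValuationCut
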